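import Summits.RiemannHypothesis.RiemannHypothesis.Theorems.ZetaStringKernelOfWeilOnComb
import Literature.NumberTheory.LFunctions.ZetaScrewThm42Proofs
import Mathlib.Topology.UniformSpace.HeineCantor
import HarnessLib

/-!
# Weil positivity on a window implies Kreĭn-kernel positivity on the open window (RH-FREE glue)

LINE 1 — LABEL: RH-FREE glue (the converse window dictionary "Weil rung ⟹ screw depth"). Nothing in
this file asserts any positivity of `ζ`'s Weil form; nothing here bears on the truth of RH.
bears_on: LADDER-RH B-D → B-P(P1) (cell rh-dbr, ET6 / TARGET-v7 §K.2 `ArchWallHolds`); companion of the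
tree's forward direction `Summit.RiemannHypothesis.RiemannHypothesis.Theorems.screwToWeilOn_proof`
(kernel positivity on `|t| ≤ a` ⟹ `WeilPositivityOn a`).

**Theorem** (`isPosSemidefKernelOn_zetaScrewKernel_of_weilPositivityOn`). For every `a : ℝ`, if
`WeilPositivityOn a` (Weil's quadratic functional is non-negative on smooth `g` supported in `[−a, a]`),
then Suzuki's kernel `G(t,u) = Ψ(t) + Ψ(u) − Ψ(t − u)` (`zetaScrewKernel`, Suzuki 2023 (1.4)) is
positive semidefinite on finite configurations in the OPEN window `(−a, a)` (Suzuki 2023 (1.5),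
`IsPosSemidefKernelOn`), i.e. `−Ψ|_{(−2a,2a)} ∈ 𝒢_a`.

**Proof** (mollified combs; the technical lemmas are in the sibling
`Theorems/ZetaStringKernelOfWeilOnComb.lean`). By the real/complex bridge `isPosSemidefKernelOn_zetaScrewKernel_iff` it
suffices to treat real weights; augmenting a configuration by the point `0` (where `G(0,·) = G(·,0) = 0`)
makes the weights sum to zero. For a zero-sum system `(sᵢ, wᵢ)` with `|sᵢ| < a` and a normalised smooth
bump `ρ_ε` of radius `ε` (Mathlib's `ContDiffBump.normed`), the comb `φ_ε = Σᵢ wᵢ ρ_ε(· − sᵢ)` is smooth,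
supported in `[−a, a]` for small `ε`, and has mean zero, i.e. `φ_ε ∈ 𝔈₀(a)` (`screwTestC0`); its primitive
`I₀^{(a)}φ_ε ∈ C(a)` (`screwPrimitive_mem_screwTestC`), so `WeilPositivityOn a` and Suzuki 2023 Prop. 3.1 in
the tree's normalisation (`weilQuadratic_eq_zetaScrewForm_deriv`) give
`0 ≤ Re ⟨φ_ε, φ_ε⟩_{G,a} = ∫∫ G(t,u) φ_ε(u) φ_ε(t) du dt = Σᵢⱼ wᵢ wⱼ ∫∫ G(t,u) ρ_ε(t − sᵢ) ρ_ε(u − sⱼ)`.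
By uniform continuity of `G` on the compact square each double integral is within `η` of `G(sᵢ, sⱼ)` once
`ε` is small, so `Σᵢⱼ wᵢ wⱼ G(sᵢ, sⱼ) ≥ −η Σ|wᵢ||wⱼ|` for every `η > 0`.

References: M. Suzuki, J. Lond. Math. Soc. (2) 108 (2023) = arXiv:2206.03682, (1.4), (1.5), (1.11),
(3.6)–(3.7), Prop. 3.1; A. Weil (1952) (positivity criterion); E. Bombieri, Rend. Mat. Acc. Lincei (9) 11
(2000) §3–4.
-/

-- `Summit.RiemannHypothesis.RiemannHypothesis.…` duplicates `RiemannHypothesis` BY DESIGN (D-0017).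
set_option linter.dupNamespace false

noncomputable section

open MeasureTheory Set Filter Metric
open scoped ComplexConjugate BigOperators Topology ContDiff

namespace Summit.RiemannHypothesis.RiemannHypothesis.Theorems.KernelOfWeilOn

open Literature.NumberTheory.LFunctions Literature.Analysis.Complex

variable {a : ℝ}

/-! ## §5 Assembly -/

/-- **Zero-sum form.** If `ζ` is Weil-positive on `[−a, a]` (`0 < a`), then for every finite zero-sum
system of real weights `wᵢ` at points `|sᵢ| < a`: `0 ≤ Σᵢⱼ wᵢ wⱼ G(sᵢ, sⱼ)`. (Mollified combs
`Σ wᵢ ρ_ε(· − sᵢ) ∈ 𝔈₀(a)`, `Re ⟨·,·⟩_{G,a} ≥ 0` there, bilinearity, and uniform continuity of `G` on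
`[−a,a]²`.) [cite: Suzuki2023, Prop 3.1 and (1.5)] -/
theorem sum_sum_zetaScrewKernel_nonneg_of_sum_eq_zero (ha : 0 < a) (hW : WeilPositivityOn a)
    {N : ℕ} (s w : Fin N → ℝ) (hs : ∀ i, |s i| < a) (hw : ∑ i, w i = 0) :
    0 ≤ ∑ i, ∑ j, w i * w j * zetaScrewKernel (s i) (s j) := by
  rcases Nat.eq_zero_or_pos N with hN | hN
  · subst hN; simp
  -- room `ε₀` between the configuration and the window edge
  haveI : Nonempty (Fin N) := Fin.pos_iff_nonempty.1 hN
  obtain ⟨i₀, -, hi₀⟩ := Finset.exists_max_image Finset.univ (fun i => |s i|) Finset.univ_nonempty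
  set ε₀ : ℝ := a - |s i₀| with hε₀def
  have hε₀ : 0 < ε₀ := by have := hs i₀; linarith
  have hroom : ∀ i, |s i| + ε₀ ≤ a := fun i => by have := hi₀ i (Finset.mem_univ _); linarith
  -- it suffices to beat every `δ > 0`
  refine le_of_forall_pos_le_add fun δ hδ => ?_
  set C : ℝ := ∑ i, ∑ j, |w i| * |w j| with hCdef
  have hC : 0 ≤ C := Finset.sum_nonneg fun i _ => Finset.sum_nonneg fun j _ => by positivity
  set η : ℝ := δ / (C + 1) with hηdef
  have hη : 0 < η := by positivity
  have hηC : η * C ≤ δ := by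
    rw [hηdef, div_mul_eq_mul_div, div_le_iff₀ (by positivity)]
    nlinarith
  -- uniform continuity of `G` on the compact square
  have hUC := (isCompact_Icc.prod isCompact_Icc : IsCompact (Icc (-a) a ×ˢ Icc (-a) a))
    |>.uniformContinuousOn_of_continuous continuous_zetaScrewKernel_uncurry.continuousOn
  rw [Metric.uniformContinuousOn_iff] at hUC
  obtain ⟨θ, hθ, hθ'⟩ := hUC η hη
  -- the bump radius
  set ε : ℝ := min θ ε₀ / 2 with hεdef
  have hε : 0 < ε := by positivity
  have hεθ : ε < θ := by
    have := min_le_left θ ε₀; rw [hεdef]; linarith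
  have hεε₀ : ε ≤ ε₀ := by
    have := min_le_right θ ε₀; rw [hεdef]; linarith [le_min hθ.le hε₀.le]
  let β : ContDiffBump (0 : ℝ) := ⟨ε / 2, ε, by positivity, by linarith⟩
  have hβ : β.rOut = ε := rfl
  have hsβ : ∀ i, |s i| + β.rOut ≤ a := fun i => by rw [hβ]; linarith [hroom i]
  -- modulus of `G` near each pair of nodes
  have hG : ∀ i j t u, |t - s i| < β.rOut → |u - s j| < β.rOut →
      |zetaScrewKernel t u - zetaScrewKernel (s i) (s j)| ≤ η := by
    intro i j t u ht hu
    rw [hβ] at ht hu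
    have hmem : ∀ {x c : ℝ}, |x - c| < ε → |c| + β.rOut ≤ a → x ∈ Icc (-a) a := by
      intro x c hx hc
      rw [hβ] at hc
      have h1 : |x| ≤ a := by have := abs_sub_abs_le_abs_sub x c; linarith
      exact ⟨(abs_le.1 h1).1, (abs_le.1 h1).2⟩
    have hsi : ∀ k, s k ∈ Icc (-a) a := fun k =>
      ⟨(abs_le.1 (hs k).le).1, (abs_le.1 (hs k).le).2⟩
    have h := hθ' (t, u) ⟨hmem ht (hsβ i), hmem hu (hsβ j)⟩ (s i, s j) ⟨hsi i, hsi j⟩ ?_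
    · exact (Real.dist_eq _ _ ▸ h).le
    · rw [Prod.dist_eq, Real.dist_eq, Real.dist_eq]
      exact max_lt (ht.trans hεθ) (hu.trans hεθ)
  -- the comb and the non-negativity of the form on it
  have hmem := comb_mem_screwTestC0 (a := a) s w β hsβ hw
  have h1 := re_zetaScrewForm_nonneg_of_weilPositivityOn ha hW hmem
  rw [re_zetaScrewForm_ofReal] at h1
  -- bilinear expansion of `D(comb, comb)`
  have hρc : ∀ i, Continuous fun u => β.normed volume (u - s i) := fun i => continuous_normed_sub β (s i)
  have h2 : doubleInt a (comb s w β) (comb s w β) =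
      ∑ j, w j * ∑ i, w i * doubleInt a (fun u => β.normed volume (u - s j))
        (fun t => β.normed volume (t - s i)) := by
    have e1 : doubleInt a (comb s w β) (comb s w β) =
        ∑ j, w j * doubleInt a (fun u => β.normed volume (u - s j)) (comb s w β) :=
      doubleInt_sum_left Finset.univ w hρc (continuous_comb s w β)
    rw [e1]
    refine Finset.sum_congr rfl fun j _ => ?_
    have e2 : doubleInt a (fun u => β.normed volume (u - s j)) (comb s w β) =
        ∑ i, w i * doubleInt a (fun u => β.normed volume (u - s j))
          (fun t => β.normed volume (t - s i)) :=
      doubleInt_sum_right Finset.univ w (hρc j) hρc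
    rw [e2]
  -- termwise comparison with the point values
  have h3 : |(∑ j, w j * ∑ i, w i * doubleInt a (fun u => β.normed volume (u - s j))
        (fun t => β.normed volume (t - s i)))
      - ∑ j, w j * ∑ i, w i * zetaScrewKernel (s i) (s j)| ≤ η * C := by
    calc |(∑ j, w j * ∑ i, w i * doubleInt a (fun u => β.normed volume (u - s j))
            (fun t => β.normed volume (t - s i)))
          - ∑ j, w j * ∑ i, w i * zetaScrewKernel (s i) (s j)|
        = |∑ j, w j * ∑ i, w i * (doubleInt a (fun u => β.normed volume (u - s j))
            (fun t => β.normed volume (t - s i)) - zetaScrewKernel (s i) (s j))| := by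
          congr 1
          rw [← Finset.sum_sub_distrib]
          refine Finset.sum_congr rfl fun j _ => ?_
          rw [← mul_sub, ← Finset.sum_sub_distrib]
          congr 1
          refine Finset.sum_congr rfl fun i _ => ?_
          ring
      _ ≤ ∑ j, |w j * ∑ i, w i * (doubleInt a (fun u => β.normed volume (u - s j))
            (fun t => β.normed volume (t - s i)) - zetaScrewKernel (s i) (s j))| :=
          Finset.abs_sum_le_sum_abs _ _
      _ ≤ ∑ j, |w j| * ∑ i, |w i| * η := by
          refine Finset.sum_le_sum fun j _ => ?_
          rw [abs_mul]
          refine mul_le_mul_of_nonneg_left ?_ (abs_nonneg _)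
          refine (Finset.abs_sum_le_sum_abs _ _).trans (Finset.sum_le_sum fun i _ => ?_)
          rw [abs_mul]
          exact mul_le_mul_of_nonneg_left (abs_doubleInt_sub_le (a := a) β (hsβ i) (hsβ j) (hG i j))
            (abs_nonneg _)
      _ = η * C := by
          rw [hCdef, Finset.mul_sum]
          refine Finset.sum_congr rfl fun j _ => ?_
          rw [Finset.mul_sum, Finset.mul_sum]
          refine Finset.sum_congr rfl fun i _ => ?_
          ring
  -- the target double sum, re-indexed
  have h5 : ∑ i, ∑ j, w i * w j * zetaScrewKernel (s i) (s j) =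
      ∑ j, w j * ∑ i, w i * zetaScrewKernel (s i) (s j) := by
    rw [Finset.sum_comm]
    refine Finset.sum_congr rfl fun j _ => ?_
    rw [Finset.mul_sum]
    refine Finset.sum_congr rfl fun i _ => ?_
    ring
  rw [h5]
  rw [h2] at h1
  have h6 := (abs_sub_le_iff.1 h3).1
  linarith

/-- **Weil positivity on `[−a, a]` ⟹ `G = Ψ(t) + Ψ(u) − Ψ(t−u)` is positive semidefinite on the open
window `(−a, a)`** (Suzuki 2023 (1.5): `−Ψ|_{(−2a,2a)} ∈ 𝒢_a`). RH-FREE glue, converse of the tree's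
`screwToWeilOn_proof`; with it every certified Weil rung `WeilPositivityOn a` of the tree becomes a
Kreĭn-kernel / screw-depth statement. (Real weights suffice by `isPosSemidefKernelOn_zetaScrewKernel_iff`;
augment by the node `0`, where `G` vanishes, to reach the zero-sum form.) [cite: Suzuki2023, (1.4)–(1.5) and Prop 3.1] -/
theorem isPosSemidefKernelOn_zetaScrewKernel_of_weilPositivityOn (hW : WeilPositivityOn a) :
    IsPosSemidefKernelOn (fun t u : ℝ => (zetaScrewKernel t u : ℂ)) (Ioo (-a) a) := by
  rw [isPosSemidefKernelOn_zetaScrewKernel_iff]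
  intro N t x ht
  rcases Nat.eq_zero_or_pos N with hN | hN
  · subst hN; simp
  have ha : 0 < a := by
    have h := ht ⟨0, hN⟩
    linarith [h.1, h.2]
  -- augmented zero-sum system
  set s : Fin (N + 1) → ℝ := Fin.cons 0 t with hsdef
  set w : Fin (N + 1) → ℝ := Fin.cons (-∑ i, x i) x with hwdef
  have hs : ∀ i, |s i| < a := by
    intro i
    refine Fin.cases ?_ (fun i => ?_) i
    · simp [hsdef, ha]
    · simpa [hsdef] using abs_lt.2 (ht i)
  have hw : ∑ i, w i = 0 := by simp [hwdef, Fin.sum_univ_succ]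
  have key := sum_sum_zetaScrewKernel_nonneg_of_sum_eq_zero ha hW s w hs hw
  -- `Σ wᵢwⱼ G(sᵢ,sⱼ) = −Σ wᵢwⱼ Ψ(sᵢ − sⱼ)` for zero-sum weights, and the augmentation identity
  have hG : ∑ i, ∑ j, w i * w j * zetaScrewKernel (s i) (s j) =
      -∑ i, ∑ j, w i * w j * zetaScrew (s i - s j) := by
    simp only [zetaScrewKernel, mul_add, mul_sub, Finset.sum_add_distrib, Finset.sum_sub_distrib,
      Suzuki2023Thm42.sum_sum_mul_mul_eq_zero_left w hw (fun i => zetaScrew (s i)),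
      Suzuki2023Thm42.sum_sum_mul_mul_eq_zero_right w hw (fun j => zetaScrew (s j))]
    ring
  rw [Suzuki2023Thm42.sum_sum_zetaScrewKernel_eq_neg t x]
  rw [hG] at key
  simpa [hsdef, hwdef] using key

/-- The same glue in the real-form language of the route theses (`Σᵢⱼ G(tᵢ,tⱼ) xᵢ xⱼ ≥ 0` for
`|tᵢ| < a`). [cite: Suzuki2023, (1.5)] -/
theorem sum_sum_zetaScrewKernel_nonneg_of_weilPositivityOn (hW : WeilPositivityOn a)
    {N : ℕ} (t x : Fin N → ℝ) (ht : ∀ i, |t i| < a) :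
    0 ≤ ∑ i, ∑ j, zetaScrewKernel (t i) (t j) * (x i * x j) :=
  (isPosSemidefKernelOn_zetaScrewKernel_iff _).1
    (isPosSemidefKernelOn_zetaScrewKernel_of_weilPositivityOn hW) N t x
    fun i => by simpa [mem_Ioo, abs_lt] using ht i

end Summit.RiemannHypothesis.RiemannHypothesis.Theorems.KernelOfWeilOn

end
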